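import Literature.AnabelianGeometry.SemiGraphs.TemperedCompactInVerticialFinite
import HarnessLib

/-!
# [SemiAnbd] Thm 3.7 (iii) beyond finite `𝔾`: NO VERTICAL BRANCHING of fixed loci at finite-valence vertices

Mochizuki, *Semi-graphs of anabelioids*, Publ. RIMS **42** (2006) [MochizukiSemiAnbd2006], §3,
Theorem 3.7 (iii), author's manuscript pp. 40–41, proof p. 41 with the author's *Comments* (2020)
item (6)(b) ("`H` … is … contained, for two distinct branches `b, b′` abutting to `v` … in the intersection
of the images of `π̂₁(𝒢_e)`, `π̂₁(𝒢_{e′})`, via `b, b′`.  But since `𝒢` is assumed to be totally estranged, we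
thus conclude that `H` is trivial") [cite: MochizukiSemiAnbd2006, Thm 3.7(iii) p.41]; the printed proof is a
proof for FINITE `𝔾` (kernel theorem `compactInVerticialAt_of_finiteGraph`, p431007); the cell's ∀-countable
typing `CompactInVerticial` is REFUTED in the kernel (`not_compactInVerticial`, p442260) by escape of the
fixed loci along the END of a ray of anabelioids (abc-iut-L3-d1's `𝒢_θ`).

CHARACTERISATION LEMMA (abc-iut cell, L3, G2 characterisation lane; seat abc-iut-L3-t8 gen 5, memo
HOME/staging/L3/L3-t8/g5/G2-CHARACTERISATION-L3t8g5.md §3 (C); PROOF-ONLY, 0 definitions, no named fact):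
the COMPLEMENTARY localisation statement — **at a vertex `w` of FINITE valence of ANY countable `𝒢`
satisfying the hypotheses of Thm. 3.7, the finite-level fixed loci of a nontrivial compact subgroup
`C ≤ π₁^temp(𝒢)` eventually never branch across two distinct branches of `𝔾` at `w`**: there is a level
`n₀` such that for `n ≥ n₀`, at every vertex of the finite Galois level `𝔾_{S n}` (resp. of the tree `𝔾̃_n`)
over `w`, any two `C`-fixed branches lie over the SAME branch of `𝔾` (`eventually_sameBranch_of_fixed`,
tower form with the (I4′)_cpt identification as a binder; `…_temperedPiChart` / `…_tree_temperedPiChart`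
unconditional at the canonical chart).  Consequences recorded in the memo: «vertical escape» (SHAPES-Ggt6g32
§(f) (V), the drift regime) never happens at finite valence; for locally finite `𝔾` the escape of the
countermodel is necessarily horizontal, along an end.

Proof = print's sub-joint argument WITHOUT the finiteness of `𝔾`: if cross-branch fixed pairs over `w`
occurred at infinitely many levels, then — the branches at `w` being finitely many — one pair of distinct
branches `(b₁, b₂)` of `𝔾` at `w` occurs infinitely often; the push-downs of the witnesses to each level `n`
range in the FINITE fibres of `𝔾_{S n}` over `w`, `b₁`, `b₂`, so Kőnig (`SemiGraph.exists_compatible_of_finite`,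
abc-iut-L3-t11) yields a COMPATIBLE `C`-fixed branch-pair system, which (I4′)_cpt (abc-iut-L3-t11's
`stabBranchPairCpt'_ofTower` via abc-iut-L3-t8's `stabBranchPairCpt'_temperedPiChart`) and total estrangement
(abc-iut-w4-d064's `noFixedBranchPairSystem_of_isTotallyEstranged_cpt`) forbid for `C ≠ 1`.  Nothing here
bears on [IUTchIII] Cor. 3.12 (IUT uses finite dual semi-graphs only).
-/

namespace Literature.AnabelianGeometry.SemiGraphs

namespace ProfiniteSemiGraph

open CategoryTheory Topology

universe u

namespace GaloisLevelData

variable {𝒢 : ProfiniteSemiGraph.{u}} (D : GaloisLevelData 𝒢) (h𝒢 : 𝒢.IsCountable)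
  (c : TemperedPiChart 𝒢) (ρ : c.G →* D.temperedPi h𝒢)
  (hconn : ∀ (n : ℕ) (p q : (D.S n).Point), (D.S n).SameComponent p q)
  (hfin : ∀ n, (D.S n).IsFinite)

/-! ### Finite fibres of the finite levels over a vertex / a branch of `𝔾` -/

include hfin in
/-- The vertices of the finite Galois level `𝔾_{S n}` over a given vertex `w` of `𝔾` form a finite set (the
fibre `(S n)_w` is finite). [cite: MochizukiSemiAnbd2006, Thm 3.7(iii) p.41] -/
theorem finite_oVertex_over (n : ℕ) (w : 𝒢.graph.Vertex) :
    {W : (D.S n).orbitGraph.Vertex | CovObj.OVertex.base _ W = w}.Finite := by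
  haveI : Finite ((D.S n).SV w).obj.V := (hfin n).finite_V w
  have hsub : {W : (D.S n).orbitGraph.Vertex | CovObj.OVertex.base _ W = w} ⊆
      Set.range (fun x : ((D.S n).SV w).obj.V => (Quot.mk _ ⟨w, x⟩ : (D.S n).OVertex)) := by
    intro W hW
    induction W using Quot.ind with
    | mk p =>
      obtain ⟨v, x⟩ := p
      change v = w at hW
      subst hW
      exact ⟨x, rfl⟩
  exact (Set.finite_range _).subset hsub

include hfin in
/-- The branches of the finite Galois level `𝔾_{S n}` over a given branch `b` of `𝔾` form a finite set (the
fibre `(S n)_e`, `e` the edge of `b`, is finite). [cite: MochizukiSemiAnbd2006, Thm 3.7(iii) p.41] -/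
theorem finite_oBranch_over (n : ℕ) (b : 𝒢.graph.Branch) :
    {β : (D.S n).orbitGraph.Branch | β.1.1 = b}.Finite := by
  haveI : Finite ((D.S n).SE (𝒢.graph.edgeOf b)).obj.V := (hfin n).finite_E _
  have hsub : {β : (D.S n).orbitGraph.Branch | β.1.1 = b} ⊆
      Set.range (fun y : ((D.S n).SE (𝒢.graph.edgeOf b)).obj.V =>
        (⟨(b, Quot.mk _ ⟨𝒢.graph.edgeOf b, y⟩), rfl⟩ : (D.S n).orbitGraph.Branch)) := by
    rintro ⟨⟨b', E⟩, hE⟩ hβ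
    change b' = b at hβ
    subst hβ
    induction E using Quot.ind with
    | mk q =>
      obtain ⟨e, y⟩ := q
      change e = 𝒢.graph.edgeOf b' at hE
      subst hE
      exact ⟨y, rfl⟩
  exact (Set.finite_range _).subset hsub

/-! ### A pigeonhole over a finite set of labels -/

/-- If infinitely often some label from a finite set occurs, one label occurs infinitely often.
[cite: MochizukiSemiAnbd2006, Thm 3.7(iii) p.41] -/
private theorem exists_frequently_of_finite {α : Type*} {s : Set α} (hs : s.Finite) (Q : ℕ → α → Prop)
    (h : ∀ n₀ : ℕ, ∃ n, n₀ ≤ n ∧ ∃ a ∈ s, Q n a) :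
    ∃ a ∈ s, ∀ n₀ : ℕ, ∃ n, n₀ ≤ n ∧ Q n a := by
  classical
  by_contra hcon
  push Not at hcon
  choose! N hN using hcon
  obtain ⟨n, hn, a, ha, hQ⟩ := h (hs.toFinset.sup N)
  exact hN a ha n ((Finset.le_sup (hs.mem_toFinset.mpr ha)).trans hn) hQ

/-! ### No vertical branching at a finite-valence vertex -/

include hfin in
/-- **No vertical branching of fixed loci at a finite-valence vertex (tower form).**  Let `D` be a Galois
tower with finite connected levels, `c` a chart acting through `ρ`, and `C ≤ c.G` a NONTRIVIAL subgroup for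
which the (I4′)_cpt identification holds (elements of `C` fixing a compatible branch-pair system of the finite
levels lie, after a homomorphism injective on `C`, in two distinct branch-conjugates — abc-iut-L3-t11's
`stabBranchPairCpt'_ofTower` for compact `C`).  If `𝒢` is totally estranged (Thm. 3.7 hypotheses) and the
vertex `w` of `𝔾` has finitely many branches, then from some level on, at every vertex of `𝔾_{S n}` over `w`,
ANY TWO `C`-FIXED BRANCHES LIE OVER THE SAME BRANCH OF `𝔾` (print's sub-joint argument, p. 41 / Comments
(6)(b), localised at `w`: finiteness of `𝔾` is replaced by finiteness of the fibres over `w`).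
[cite: MochizukiSemiAnbd2006, Thm 3.7(iii) p.41] -/
theorem eventually_sameBranch_of_fixed (h37 : 𝒢.Thm37Hypotheses) (C : Subgroup c.G) (hC : C ≠ ⊥)
    (stabBranchPairC : ∀ (j₀ : ℕ) (w : ∀ i : {i : ℕ // j₀ ≤ i}, (D.S i.1).orbitGraph.Vertex)
      (β β' : ∀ i : {i : ℕ // j₀ ≤ i}, (D.S i.1).orbitGraph.Branch),
      (∀ i, β i ≠ β' i ∧ (D.S i.1).orbitGraph.abuts (β i) = some (w i) ∧
        (D.S i.1).orbitGraph.abuts (β' i) = some (w i)) →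
      (∀ ⦃i i' : {i : ℕ // j₀ ≤ i}⦄ (h : i.1 ≤ i'.1), (D.levelTrans h).vertexMap (w i') = w i ∧
        (D.levelTrans h).branchMap (β i') = β i ∧ (D.levelTrans h).branchMap (β' i') = β' i) →
      ∃ (Q : Type u) (_ : Group Q) (ιQ : c.G →* Q) (v : 𝒢.graph.Vertex) (b b' : 𝒢.graph.Branch)
        (hb : 𝒢.graph.abuts b = some v) (hb' : 𝒢.graph.abuts b' = some v) (ψ : 𝒢.Gv v →* Q)
        (x x' : 𝒢.Gv v),
        Set.InjOn ιQ C ∧ Function.Injective ψ ∧ (b' ≠ b ∨ x⁻¹ * x' ∉ 𝒢.branchSubgroup b v hb) ∧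
        ∀ g ∈ C, (∀ i, (D.levelAct h𝒢 hconn i.1 (ρ g)).hom.vertexMap (w i) = w i ∧
          (D.levelAct h𝒢 hconn i.1 (ρ g)).hom.branchMap (β i) = β i ∧
          (D.levelAct h𝒢 hconn i.1 (ρ g)).hom.branchMap (β' i) = β' i) →
          ιQ g ∈ ((𝒢.branchSubgroup b v hb).map (MulAut.conj x).toMonoidHom).map ψ ⊓
            ((𝒢.branchSubgroup b' v hb').map (MulAut.conj x').toMonoidHom).map ψ)
    (w : 𝒢.graph.Vertex) (hw : {b : 𝒢.graph.Branch | 𝒢.graph.abuts b = some w}.Finite) :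
    ∃ n₀ : ℕ, ∀ n, n₀ ≤ n → ∀ (W : (D.S n).orbitGraph.Vertex) (β β' : (D.S n).orbitGraph.Branch),
      CovObj.OVertex.base _ W = w → (D.S n).orbitGraph.abuts β = some W →
      (D.S n).orbitGraph.abuts β' = some W →
      (∀ γ ∈ C, (D.levelAct h𝒢 hconn n (ρ γ)).hom.branchMap β = β) →
      (∀ γ ∈ C, (D.levelAct h𝒢 hconn n (ρ γ)).hom.branchMap β' = β') →
      (D.S n).orbitGraphProj.branchMap β = (D.S n).orbitGraphProj.branchMap β' := by
  classical
  by_contra hcon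
  push Not at hcon
  /- STEP 1: one pair of DISTINCT branches `(b₁, b₂)` of `𝔾` at `w` carries cross pairs at infinitely many
  levels (finitely many branches at `w`). -/
  let P : Set (𝒢.graph.Branch × 𝒢.graph.Branch) :=
    {p | 𝒢.graph.abuts p.1 = some w ∧ 𝒢.graph.abuts p.2 = some w}
  have hP : P.Finite := (hw.prod hw).subset fun p hp => ⟨hp.1, hp.2⟩
  let Q : ℕ → 𝒢.graph.Branch × 𝒢.graph.Branch → Prop := fun n p =>
    ∃ (W : (D.S n).orbitGraph.Vertex) (β β' : (D.S n).orbitGraph.Branch),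
      CovObj.OVertex.base _ W = w ∧ (D.S n).orbitGraph.abuts β = some W ∧
      (D.S n).orbitGraph.abuts β' = some W ∧
      (∀ γ ∈ C, (D.levelAct h𝒢 hconn n (ρ γ)).hom.branchMap β = β) ∧
      (∀ γ ∈ C, (D.levelAct h𝒢 hconn n (ρ γ)).hom.branchMap β' = β') ∧
      β.1.1 ≠ β'.1.1 ∧ β.1.1 = p.1 ∧ β'.1.1 = p.2
  have hQ : ∀ n₀ : ℕ, ∃ n, n₀ ≤ n ∧ ∃ p ∈ P, Q n p := by
    intro n₀
    obtain ⟨n, hn, W, β, β', hW, hβ, hβ', hfix, hfix', hne⟩ := hcon n₀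
    refine ⟨n, hn, (β.1.1, β'.1.1), ⟨?_, ?_⟩, W, β, β', hW, hβ, hβ', hfix, hfix', hne, rfl, rfl⟩
    · have h1 := (D.S n).orbitGraphProj.abuts_branchMap β W hβ
      rw [← hW]; exact h1
    · have h1 := (D.S n).orbitGraphProj.abuts_branchMap β' W hβ'
      rw [← hW]; exact h1
  obtain ⟨⟨b₁, b₂⟩, ⟨hb₁, hb₂⟩, hfreq⟩ := exists_frequently_of_finite hP Q hQ
  have hb₁₂ : b₁ ≠ b₂ := by
    obtain ⟨n, -, W, β, β', -, -, -, -, -, hne, h1, h2⟩ := hfreq 0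
    have h1' : β.1.1 = b₁ := h1
    have h2' : β'.1.1 = b₂ := h2
    rw [← h1', ← h2']; exact hne
  /- STEP 2: the inverse system of cross pairs of type `(b₁, b₂)` over `w` — finite fibres, nonempty,
  stable — has a compatible family (Kőnig). -/
  let X : ℕ → Type u := fun n =>
    (D.S n).orbitGraph.Vertex × ((D.S n).orbitGraph.Branch × (D.S n).orbitGraph.Branch)
  let f : ∀ ⦃i j : ℕ⦄, i ≤ j → X j → X i := fun i j h t =>
    ((D.levelTrans h).vertexMap t.1, ((D.levelTrans h).branchMap t.2.1, (D.levelTrans h).branchMap t.2.2))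
  have f_id : ∀ (i : ℕ) (t : X i), f le_rfl t = t := by
    rintro i ⟨W, β, β'⟩
    simp only [f, D.levelTrans_self, SemiGraph.id_vertexMap, SemiGraph.id_branchMap, id]
  have f_comp : ∀ ⦃i j k : ℕ⦄ (hij : i ≤ j) (hjk : j ≤ k) (t : X k),
      f hij (f hjk t) = f (hij.trans hjk) t := by
    rintro i j k hij hjk ⟨W, β, β'⟩
    simp only [f, D.levelTrans_vertexMap_comp, D.levelTrans_branchMap_comp]
  let F : ∀ n, Set (X n) := fun n =>
    {t | CovObj.OVertex.base _ t.1 = w ∧ t.2.1.1.1 = b₁ ∧ t.2.2.1.1 = b₂ ∧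
      (D.S n).orbitGraph.abuts t.2.1 = some t.1 ∧ (D.S n).orbitGraph.abuts t.2.2 = some t.1 ∧
      (∀ γ ∈ C, (D.levelAct h𝒢 hconn n (ρ γ)).hom.vertexMap t.1 = t.1) ∧
      (∀ γ ∈ C, (D.levelAct h𝒢 hconn n (ρ γ)).hom.branchMap t.2.1 = t.2.1) ∧
      (∀ γ ∈ C, (D.levelAct h𝒢 hconn n (ρ γ)).hom.branchMap t.2.2 = t.2.2)}
  have hFfin : ∀ n, (F n).Finite := by
    intro n
    refine ((D.finite_oVertex_over hfin n w).prod
      ((D.finite_oBranch_over hfin n b₁).prod (D.finite_oBranch_over hfin n b₂))).subset ?_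
    rintro ⟨W, β, β'⟩ ⟨hW, h1, h2, -⟩
    exact ⟨hW, h1, h2⟩
  -- a fixed branch has a fixed abutment vertex
  have fixV : ∀ (n : ℕ) (W : (D.S n).orbitGraph.Vertex) (β : (D.S n).orbitGraph.Branch)
      (φ : (D.S n).orbitGraph ⟶ (D.S n).orbitGraph),
      (D.S n).orbitGraph.abuts β = some W → φ.branchMap β = β → φ.vertexMap W = W := by
    intro n W β φ hβ hφ
    have h1 := φ.abuts_branchMap β W hβ
    rw [hφ, hβ] at h1
    exact (Option.some.inj h1).symm
  have hmap : ∀ ⦃i j : ℕ⦄ (h : i ≤ j) (t : X j), t ∈ F j → f h t ∈ F i := by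
    rintro i j h ⟨W, β, β'⟩ ⟨hW, h1, h2, hβ, hβ', hfW, hfβ, hfβ'⟩
    refine ⟨?_, ?_, ?_, ?_, ?_, ?_, ?_, ?_⟩
    · exact (D.base_levelTrans_vertexMap h W).trans hW
    · exact (D.proj_branchMap_levelTrans h β).trans h1
    · exact (D.proj_branchMap_levelTrans h β').trans h2
    · exact (D.levelTrans h).abuts_branchMap β W hβ
    · exact (D.levelTrans h).abuts_branchMap β' W hβ'
    · intro γ hγ
      have e := D.levelTrans_vertexMap_act h𝒢 hconn c ρ γ h W
      rw [hfW γ hγ] at e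
      exact e.symm
    · intro γ hγ
      have e := D.levelTrans_branchMap_act h𝒢 hconn c ρ γ h β
      rw [hfβ γ hγ] at e
      exact e.symm
    · intro γ hγ
      have e := D.levelTrans_branchMap_act h𝒢 hconn c ρ γ h β'
      rw [hfβ' γ hγ] at e
      exact e.symm
  have hFne : ∀ n, (F n).Nonempty := by
    intro n
    obtain ⟨m, hnm, W, β, β', hW, hβ, hβ', hfix, hfix', -, h1, h2⟩ := hfreq n
    have hmem : (⟨W, β, β'⟩ : X m) ∈ F m :=
      ⟨hW, h1, h2, hβ, hβ', fun γ hγ => fixV m W β _ hβ (hfix γ hγ), hfix, hfix'⟩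
    exact ⟨f hnm ⟨W, β, β'⟩, hmap hnm _ hmem⟩
  obtain ⟨x, hxF, hxc⟩ := SemiGraph.exists_compatible_of_finite f f_id f_comp F hFfin hFne hmap
  /- STEP 3: a compatible `C`-fixed branch-pair system with distinct base branches contradicts total
  estrangement via (I4′)_cpt. -/
  have hbot : C = ⊥ :=
    noFixedBranchPairSystem_of_isTotallyEstranged_cpt h37 c (fun n => (D.S n).orbitGraph)
      (fun n => (D.levelAct h𝒢 hconn n).comp ρ) (fun _ _ h => D.levelTrans h) C stabBranchPairC 0
      (fun i => (x i.1).1) (fun i => (x i.1).2.1) (fun i => (x i.1).2.2)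
      (fun i => by
        obtain ⟨-, h1, h2, hβ, hβ', -⟩ := hxF i.1
        refine ⟨fun heq => hb₁₂ ?_, hβ, hβ'⟩
        rw [← h1, ← h2, heq])
      (fun i i' h => by
        have e := hxc h
        exact ⟨congrArg Prod.fst e, congrArg (fun t => t.2.1) e, congrArg (fun t => t.2.2) e⟩)
      (fun i γ => by
        obtain ⟨-, -, -, -, -, hfW, hfβ, hfβ'⟩ := hxF i.1
        exact ⟨hfW γ γ.2, hfβ γ γ.2, hfβ' γ γ.2⟩)
  exact hC hbot

end GaloisLevelData

/-! ### At the tempered fundamental group chart of Proposition 3.6 (unconditional) -/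

variable (𝒢 : ProfiniteSemiGraph.{u})

/-- **No vertical branching of fixed loci at a finite-valence vertex, for the tempered fundamental group
`π₁^temp(𝒢)` of Prop. 3.6 (finite Galois levels `𝔾_{S n}` of the canonical tower).**  For every countable `𝒢`
satisfying the hypotheses of Thm. 3.7, every vertex `w` of `𝔾` with finitely many branches, and every
NONTRIVIAL COMPACT `C ≤ π₁^temp(𝒢)`: from some level on, at every vertex of `𝔾_{S n}` over `w`, any two
`C`-fixed branches lie over the same branch of `𝔾`.  ((I4′)_cpt = abc-iut-L3-t8's
`stabBranchPairCpt'_temperedPiChart` with (I0v) = abc-iut-L3-t6's `galoisLevelData_faithfulV`; NO finiteness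
of `𝔾`.) [cite: MochizukiSemiAnbd2006, Thm 3.7(iii) p.41] -/
theorem eventually_sameBranch_of_fixed_temperedPiChart (h37 : 𝒢.Thm37Hypotheses)
    (C : Subgroup (𝒢.temperedPiChart h37.toProp36Hypotheses).G)
    (hCcpt : IsCompact (C : Set (𝒢.temperedPiChart h37.toProp36Hypotheses).G)) (hC : C ≠ ⊥)
    (w : 𝒢.graph.Vertex) (hw : {b : 𝒢.graph.Branch | 𝒢.graph.abuts b = some w}.Finite) :
    ∃ n₀ : ℕ, ∀ n, n₀ ≤ n →
      ∀ (W : ((𝒢.galoisLevelData h37.toProp36Hypotheses).S n).orbitGraph.Vertex)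
        (β β' : ((𝒢.galoisLevelData h37.toProp36Hypotheses).S n).orbitGraph.Branch),
      CovObj.OVertex.base _ W = w →
      ((𝒢.galoisLevelData h37.toProp36Hypotheses).S n).orbitGraph.abuts β = some W →
      ((𝒢.galoisLevelData h37.toProp36Hypotheses).S n).orbitGraph.abuts β' = some W →
      (∀ γ ∈ C, ((𝒢.galoisLevelData h37.toProp36Hypotheses).levelAct h37.toProp36Hypotheses.isCountable
        (𝒢.galoisLevelData_hconn h37.toProp36Hypotheses) n γ).hom.branchMap β = β) →
      (∀ γ ∈ C, ((𝒢.galoisLevelData h37.toProp36Hypotheses).levelAct h37.toProp36Hypotheses.isCountable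
        (𝒢.galoisLevelData_hconn h37.toProp36Hypotheses) n γ).hom.branchMap β' = β') →
      ((𝒢.galoisLevelData h37.toProp36Hypotheses).S n).orbitGraphProj.branchMap β =
        ((𝒢.galoisLevelData h37.toProp36Hypotheses).S n).orbitGraphProj.branchMap β' :=
  (𝒢.galoisLevelData h37.toProp36Hypotheses).eventually_sameBranch_of_fixed h37.toProp36Hypotheses.isCountable
    (𝒢.temperedPiChart h37.toProp36Hypotheses) (MonoidHom.id _)
    (𝒢.galoisLevelData_hconn h37.toProp36Hypotheses) (𝒢.galoisLevelData_isFinite h37.toProp36Hypotheses)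
    h37 C hC
    (𝒢.stabBranchPairCpt'_temperedPiChart h37.toProp36Hypotheses (galoisLevelData_faithfulV 𝒢 h37) C hCcpt)
    w hw

/-- **Tree form** (the fixed sub-tree of `C` in `𝔾̃_n = 𝒢_{∞,S n}` does not branch across two branches of
`𝔾` at vertices over a finite-valence `w`, from some level on): for every nontrivial compact `C ≤ π₁^temp(𝒢)`
there is `n₀` such that for `n ≥ n₀`, at every vertex of the tree `𝔾̃_n` over `w`, any two `C`-fixed branches
lie over the same branch of `𝔾`.  (Pushed down to `𝔾_{S n}` along the immersion `𝔾̃_n → 𝔾_{S n}`.)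
[cite: MochizukiSemiAnbd2006, Thm 3.7(iii) p.41] -/
theorem eventually_sameBranch_of_fixed_tree_temperedPiChart (h37 : 𝒢.Thm37Hypotheses)
    (C : Subgroup (𝒢.temperedPiChart h37.toProp36Hypotheses).G)
    (hCcpt : IsCompact (C : Set (𝒢.temperedPiChart h37.toProp36Hypotheses).G)) (hC : C ≠ ⊥)
    (w : 𝒢.graph.Vertex) (hw : {b : 𝒢.graph.Branch | 𝒢.graph.abuts b = some w}.Finite) :
    ∃ n₀ : ℕ, ∀ n, n₀ ≤ n →
      ∀ (z : ((𝒢.galoisLevelData h37.toProp36Hypotheses).tree n).Vertex)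
        (β β' : ((𝒢.galoisLevelData h37.toProp36Hypotheses).tree n).Branch),
      ((𝒢.galoisLevelData h37.toProp36Hypotheses).treeProj n).vertexMap z = w →
      ((𝒢.galoisLevelData h37.toProp36Hypotheses).tree n).abuts β = some z →
      ((𝒢.galoisLevelData h37.toProp36Hypotheses).tree n).abuts β' = some z →
      (∀ γ ∈ C, ((𝒢.galoisLevelData h37.toProp36Hypotheses).treeAct h37.toProp36Hypotheses.isCountable
        n γ).hom.branchMap β = β) →
      (∀ γ ∈ C, ((𝒢.galoisLevelData h37.toProp36Hypotheses).treeAct h37.toProp36Hypotheses.isCountable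
        n γ).hom.branchMap β' = β') →
      ((𝒢.galoisLevelData h37.toProp36Hypotheses).treeProj n).branchMap β =
        ((𝒢.galoisLevelData h37.toProp36Hypotheses).treeProj n).branchMap β' := by
  set D := 𝒢.galoisLevelData h37.toProp36Hypotheses with hD
  obtain ⟨n₀, hn₀⟩ := 𝒢.eventually_sameBranch_of_fixed_temperedPiChart h37 C hCcpt hC w hw
  refine ⟨n₀, fun n hn z β β' hz hβ hβ' hfix hfix' => ?_⟩
  have hq : ∀ (γ : (𝒢.temperedPiChart h37.toProp36Hypotheses).G) (b : (D.tree n).Branch),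
      (D.treeAct h37.toProp36Hypotheses.isCountable n γ).hom.branchMap b = b →
      (D.levelAct h37.toProp36Hypotheses.isCountable (𝒢.galoisLevelData_hconn h37.toProp36Hypotheses) n
        γ).hom.branchMap ((D.treeQuot n).branchMap b) = (D.treeQuot n).branchMap b := by
    intro γ b hb
    have e := congrArg (fun φ => SemiGraph.Hom.branchMap φ b)
      (D.treeQuot_act h37.toProp36Hypotheses.isCountable (𝒢.galoisLevelData_hconn h37.toProp36Hypotheses) n γ)
    simp only [SemiGraph.comp_branchMap, Function.comp_apply] at e
    rw [hb] at e
    exact e.symm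
  exact hn₀ n hn ((D.treeQuot n).vertexMap z) ((D.treeQuot n).branchMap β) ((D.treeQuot n).branchMap β')
    hz ((D.treeQuot n).abuts_branchMap β z hβ) ((D.treeQuot n).abuts_branchMap β' z hβ')
    (fun γ hγ => hq γ β (hfix γ hγ)) (fun γ hγ => hq γ β' (hfix' γ hγ))

end ProfiniteSemiGraph

end Literature.AnabelianGeometry.SemiGraphs
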